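import Summits.KontsevichZagierPeriods.KontsevichZagierPeriods.Theses.Grothendieck
import Summits.KontsevichZagierPeriods.KontsevichZagierPeriods.Theorems.GrothendieckKEAlgIndependent
import Summits.KontsevichZagierPeriods.KontsevichZagierPeriods.Theorems.GrothendieckLemniscaticSectorGlue

/-!
# KontsevichZagierPeriods / Grothendieck — the assembly `Assembly` (stmt-KontsevichZagierPeriods-14619)

Route `KontsevichZagierPeriods/Grothendieck` (DIMENSION COUNT CLOSES SECTORS), item
stmt-KontsevichZagierPeriods-14619 (`Assembly`, rank 1), the crux-only deciding statement:

  `GpcZeta4Eq4zeta31 → GpcLegendreLemniscatic → SectorComplement → KontsevichZagierPeriods`.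

The route's kernel-checked deciding theorem is
`closes (h₁ : GpcZeta4Eq4zeta31) (h₂ : GpcLegendreLemniscatic) (h₃ : KEAlgIndependent)
(h₄ : LemniscaticSectorGlue) (h₅ : SectorComplement) : KontsevichZagierPeriods := h₅ (h₄ h₃ h₂) h₁`.
Its two SUPPORT hypotheses are tree theorems and are discharged here instead of assumed:

* `h₃ : KEAlgIndependent` (stmt-KontsevichZagierPeriods-8611) — `K(1/√2)`, `E(1/√2)` algebraically
  independent over `ℚ` (Chudnovsky's theorem + Lawden's evaluations + Legendre's relation):
  `Summit.KontsevichZagierPeriods.Grothendieck.keAlgIndependent_proof`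
  (`Theorems/GrothendieckKEAlgIndependent.lean`);
* `h₄ : LemniscaticSectorGlue` (stmt-KontsevichZagierPeriods-8612) — the dimension count
  `KEAlgIndependent → GpcLegendreLemniscatic → LemniscaticSectorKernel`:
  `Summit.KontsevichZagierPeriods.Grothendieck.LemniscaticSectorGlue.lemniscaticSectorGlue_proof`
  (`Theorems/GrothendieckLemniscaticSectorGlue.lean`).

So the item is `closes` fed with these two proofs (`Assembly.assembly_proof`). The three remaining
antecedents — the two transfers `GpcZeta4Eq4zeta31`, `GpcLegendreLemniscatic` and the declared, NOT
CLAIMED remainder `SectorComplement` (summit strength) — are NOT discharged here: the theorem is the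
implication, nothing more. No definitions, no named facts; unconditional.

References: M. Kontsevich, D. Zagier, *Periods* (2001), §1.2, §4.1; A. Huber, S. Müller-Stach,
*Periods and Nori Motives* (2017), §13.1; G. V. Chudnovsky, *Contributions to the theory of
transcendental numbers* (1984), Ch. 7.
-/

namespace Summit.KontsevichZagierPeriods.Grothendieck.Assembly

open Summit.KontsevichZagierPeriods.KontsevichZagierPeriods.Theses.Grothendieck

/-- **`Assembly`** (settles stmt-KontsevichZagierPeriods-14619, route Grothendieck):
`GpcZeta4Eq4zeta31 → GpcLegendreLemniscatic → SectorComplement → KontsevichZagierPeriods`.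
Proof: the route's deciding theorem `closes` with its two support hypotheses discharged by the tree
theorems `keAlgIndependent_proof` (stmt-8611: `K(1/√2), E(1/√2)` algebraically independent over `ℚ`)
and `lemniscaticSectorGlue_proof` (stmt-8612: the dimension count
`KEAlgIndependent → GpcLegendreLemniscatic → LemniscaticSectorKernel`); i.e.
`fun h₁ h₂ h₅ => h₅ (lemniscaticSectorGlue_proof keAlgIndependent_proof h₂) h₁`.
[Kontsevich–Zagier 2001, §1.2, §4.1] -/
theorem assembly_proof :
    Summit.KontsevichZagierPeriods.KontsevichZagierPeriods.Theses.Grothendieck.Assembly := by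
  unfold Summit.KontsevichZagierPeriods.KontsevichZagierPeriods.Theses.Grothendieck.Assembly
  intro h₁ h₂ h₅
  exact closes h₁ h₂ Summit.KontsevichZagierPeriods.Grothendieck.keAlgIndependent_proof
    Summit.KontsevichZagierPeriods.Grothendieck.LemniscaticSectorGlue.lemniscaticSectorGlue_proof h₅

end Summit.KontsevichZagierPeriods.Grothendieck.Assembly
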